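import Summits.ValiantsHypothesis.ValiantsHypothesis.Theorems.KPlusLogSqLawTropicalBTopHeavyCoreGeneral
import Summits.ValiantsHypothesis.ValiantsHypothesis.Theorems.KPlusLogSqLawTropicalBParityCensus
import Summits.ValiantsHypothesis.ValiantsHypothesis.Theorems.KPlusLogSqLawTropicalBSplitDefs

/-!
# Route «KPlusLogSqLaw», crux `TropicalB` (stmt-ValiantsHypothesis-19771) — INSTANCES OF THE ONE-COLUMN TRANSFER LAW:
# the aligned «(2,2) → (1,3)» transfer, the core `{2^m, 1·2^{m−2}·3, 0^{m−1}4}`, and THE PARITY CORE AT EVERY SIZE (odd `m` included)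

HONEST FRAMING.  Instances of this seat's `TopHeavyCore.core_law_general` (…TopHeavyCoreGeneral; val-sym-trop-p1 g21, cell `pub-symmetroid`,
2026-08-28; `--supports stmt-ValiantsHypothesis-19771 --as helper`) and their census corollaries.  Structure / census statements about dominance
designs of every size `m ≥ 2`; nothing here bears on `TropicalB` in its window, `WeakLifting`, DoorA26 / DoorA34, `MatrixDescartes`
(stmt-ValiantsHypothesis-18050) or VP ≠ VNP.

* `transfer_aligned` — **the ALIGNED (2,2) → (1,3) TRANSFER LAW**: `P_A` with exponents in `(d c₀, d c₃]` and class `c₂` at two columns `x₁ ≠ y`,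
  `P_B = P_A` with `x₁` lowered to `c₁` and `y` raised to `c₃`, `P_C = c₀^{m−1}·` latest (`d c₀ < d c₁ < d c₂ < d c₃`, `d c₀` minimal): impossible.
  The located «transfer conjecture» (memo CORE-LAW-C-g21 §6: every ARRANGEMENT of the multiset `A − 2c₂ + c₁ + c₃`; ktight, `m ≤ 5`, 0
  counterexamples) is proved here for the aligned arrangement only.
* `core_law_Cprime` — the all-`m` form of the `(3,5)` atlas core `{2³, 1·2·3, 0²4}`: `P_A = c₂^m`, `P_B = c₁ c₂^{m−2} c₃`, `P_C = c₀^{m−1} c₄` latest.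
* `parity_core_all` — **the parity core `{c₂^m, c₁^{m−1} c₃, c₀^{m−1} c₄}` with `P_C` latest is impossible at EVERY size `m ≥ 2`** (given `d c₀`
  minimal): the tree's `ParityLaw.parity_law_chain` needs `m` even (three Hamiltonian quotients and a sign count); the one-column transfer law
  removes the parity hypothesis (located first: ktight, `{2^m, 1^{m−1}3, 0^{m−1}4}` infeasible `12/12` at `m = 3`, `8/8` at `m = 5`, both slope
  orders of `A, B`; tools/coreParOdd.py of the deposit).
* `parity_census_all`, `designRowD_parity_all` — census corollaries: **`ParityLaw.parity_census` holds WITHOUT `Even m`** (for `d c₀` minimal and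
  the two slopes below the `c₄`-slope): every chain of unique optima has `n + 2 ≤ multichoose K m`.  (In the super-increasing sector this is the
  already-landed `core_census_superIncreasing` of …TopHeavyCoreCensus, all `m ≥ 2`.)
[this cell]
-/

set_option linter.dupNamespace false
set_option autoImplicit false

namespace Summit.ValiantsHypothesis.ValiantsHypothesis.Theorems.KPlusLogSqLaw.TopHeavyCore

open Summit.ValiantsHypothesis.ValiantsHypothesis.Theorems.MatrixDescartes.Negative
open Summit.ValiantsHypothesis.ValiantsHypothesis.Theorems.LacunarySymmetroidMatrixDescartes.TropicalCensus
open Finset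

variable {m K : ℕ}

/-! ## 1. The aligned transfer law and the core `{2^m, 1·2^{m−2}·3, 0^{m−1}4}` -/

/-- **ALIGNED (2,2) → (1,3) TRANSFER.**  `d c₀ < d c₁ < d c₂ < d c₃`, `d c₀` minimal; `P_A = (σA, λA)` with `d c₀ < d (λA ·) ≤ d c₃` and class `c₂` at two
columns `x₁ ≠ y`; `P_B = (σB, λB)` with `λB = λA` except `λB x₁ = c₁`, `λB y = c₃`; `P_C = (σC, λC)` with `λC ≡ c₀` off one column; all three
dominant with `P_C` the latest.  Then `False`. [this cell] -/
theorem transfer_aligned (d : Fin K → ℕ) (v ε : Fin m → Fin m → Fin K → ℤ) (hm : 2 ≤ m)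
    {c₀ c₁ c₂ c₃ : Fin K} (h12 : d c₁ < d c₂) (h23 : d c₂ < d c₃) (hmin : ∀ l, d c₀ ≤ d l)
    {σA σB σC : Equiv.Perm (Fin m)} {lA lB lC : Fin m → Fin K} {x₁ y c : Fin m} (hxy : x₁ ≠ y)
    (hlowA : ∀ x, d c₀ < d (lA x)) (hAle : ∀ x, d (lA x) ≤ d c₃) (hAx : lA x₁ = c₂) (hAy : lA y = c₂) (h01 : d c₀ < d c₁)
    (hlB : ∀ x, lB x = if x = y then c₃ else if x = x₁ then c₁ else lA x) (hlC : ∀ x, x ≠ c → lC x = c₀)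
    {θA θB θC : ℤ} (hA : IsDominant d v ε θA (σA, lA)) (hB : IsDominant d v ε θB (σB, lB)) (hC : IsDominant d v ε θC (σC, lC))
    (hAC : θA < θC) (hBC : θB < θC) : False := by
  have hBy : lB y = c₃ := by rw [hlB y, if_pos rfl]
  have hBx : lB x₁ = c₁ := by rw [hlB x₁, if_neg hxy, if_pos rfl]
  refine core_law_general d v ε hm hlC hmin hlowA ?_ ?_ ?_ ?_ hxy ?_ hA hB hC hAC hBC (b := y) (x := x₁)
  · -- exponents of `λB` are above `d c₀`
    intro x
    rw [hlB x]
    split_ifs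
    · exact h01.trans (h12.trans h23)
    · exact h01
    · exact hlowA x
  · -- `P_B ≤ P_A` off `y`
    intro x hx
    rw [hlB x, if_neg hx]
    split_ifs with h
    · rw [h, hAx]; exact h12.le
    · exact le_rfl
  · -- `λA y` is strictly raised
    rw [hAy, hBy]; exact h23
  · -- `λB y` dominates `λA`
    intro x; rw [hBy]; exact hAle x
  · -- the second differing column `x₁`
    right
    rw [hAx, hBx]
    exact fun h => (ne_of_lt h12) (by rw [h])

/-- **CORE LAW C′ = the all-`m` form of the `(3,5)` atlas core `{2³, 1·2·3, 0²4}`.**  `d c₀ < d c₁ < d c₂ < d c₃`, `d c₀` minimal: no design has dominant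
terms `P_A = c₂^m` (all classes `c₂`), `P_B` (`c₁` at `x₁`, `c₃` at `y ≠ x₁`, `c₂` elsewhere), `P_C` (`c₄` at `c`, `c₀` elsewhere) with `P_C` the latest.
[this cell] -/
theorem core_law_Cprime (d : Fin K → ℕ) (v ε : Fin m → Fin m → Fin K → ℤ) (hm : 2 ≤ m)
    {c₀ c₁ c₂ c₃ c₄ : Fin K} (h01 : d c₀ < d c₁) (h12 : d c₁ < d c₂) (h23 : d c₂ < d c₃) (hmin : ∀ l, d c₀ ≤ d l)
    {σA σB σC : Equiv.Perm (Fin m)} {lA lB lC : Fin m → Fin K} {x₁ y c : Fin m} (hxy : x₁ ≠ y)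
    (hlA : ∀ x, lA x = c₂) (hlB : ∀ x, lB x = if x = y then c₃ else if x = x₁ then c₁ else c₂)
    (hlC : ∀ x, lC x = if x = c then c₄ else c₀)
    {θA θB θC : ℤ} (hA : IsDominant d v ε θA (σA, lA)) (hB : IsDominant d v ε θB (σB, lB)) (hC : IsDominant d v ε θC (σC, lC))
    (hAC : θA < θC) (hBC : θB < θC) : False :=
  transfer_aligned d v ε hm h12 h23 hmin hxy (fun x => by rw [hlA x]; exact h01.trans h12) (fun x => by rw [hlA x]; exact h23.le)
    (hlA x₁) (hlA y) h01 (fun x => by rw [hlB x, hlA x]) (fun x hx => by rw [hlC x, if_neg hx]) hA hB hC hAC hBC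

/-! ## 2. The parity core at every size -/

/-- **THE PARITY CORE AT EVERY SIZE.**  `d c₀ < d c₁ < d c₂ < d c₃`, `d c₀` minimal, any `m ≥ 2` (odd or even): no design has dominant terms
`P_A = c₂^m`, `P_B` (`c₃` at `b`, `c₁` elsewhere), `P_C` (`c₄` at `c`, `c₀` elsewhere) with `P_C` the latest.  (`ParityLaw.parity_law_chain`: `m` even and
`θA < θB < θC`.) [this cell] -/
theorem parity_core_all (d : Fin K → ℕ) (v ε : Fin m → Fin m → Fin K → ℤ) (hm : 2 ≤ m)
    {c₀ c₁ c₂ c₃ c₄ : Fin K} (h01 : d c₀ < d c₁) (h12 : d c₁ < d c₂) (h23 : d c₂ < d c₃) (hmin : ∀ l, d c₀ ≤ d l)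
    {σA σB σC : Equiv.Perm (Fin m)} {lA lB lC : Fin m → Fin K} {b c : Fin m}
    (hlA : ∀ x, lA x = c₂) (hlB : ∀ x, lB x = if x = b then c₃ else c₁) (hlC : ∀ x, lC x = if x = c then c₄ else c₀)
    {θA θB θC : ℤ} (hA : IsDominant d v ε θA (σA, lA)) (hB : IsDominant d v ε θB (σB, lB)) (hC : IsDominant d v ε θC (σC, lC))
    (hAC : θA < θC) (hBC : θB < θC) : False := by
  -- a second column
  obtain ⟨x, hxb⟩ : ∃ x : Fin m, x ≠ b := by
    by_contra h
    push Not at h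
    have : Fintype.card (Fin m) ≤ 1 := Fintype.card_le_one_iff.mpr fun a a' => (h a).trans (h a').symm
    rw [Fintype.card_fin] at this
    omega
  have hBb : lB b = c₃ := by rw [hlB b, if_pos rfl]
  refine core_law_general d v ε hm (fun x hx => by rw [hlC x, if_neg hx]) hmin (fun x => by rw [hlA x]; exact h01.trans h12) ?_ ?_ ?_ ?_
    hxb ?_ hA hB hC hAC hBC (b := b) (x := x)
  · intro z; rw [hlB z]; split_ifs
    · exact h01.trans (h12.trans h23)
    · exact h01
  · intro z hz; rw [hlB z, if_neg hz, hlA z]; exact h12.le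
  · rw [hlA b, hBb]; exact h23
  · intro z; rw [hlA z, hBb]; exact h23.le
  · right; rw [hlA x, hlB x, if_neg hxb]; exact fun h => (ne_of_lt h12) (by rw [h])

/-! ## 3. Census corollaries: the parity census without parity -/

/-- **PARITY CENSUS AT EVERY SIZE.**  `m ≥ 2` (any parity); five classes with `d c₀ < d c₁ < d c₂ < d c₃`, `d c₀` minimal, and the slopes of
`c₂^m` and `c₁^{m−1}c₃` below that of `c₀^{m−1}c₄` (`m·d c₂ < (m−1)·d c₀ + d c₄`, `(m−1)·d c₁ + d c₃ < (m−1)·d c₀ + d c₄`).  Every chain of unique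
optima at strictly increasing slopes with consecutive terms distinct has `n + 2 ≤ multichoose K m` (it misses `c₂^m`, `c₁^{m−1}c₃` or `c₀^{m−1}c₄`).
Compare `ParityLaw.parity_census` (`m` even; no minimality of `d c₀` needed there). [this cell] -/
theorem parity_census_all (hm : 2 ≤ m) (d : Fin K → ℕ) (v ε : Fin m → Fin m → Fin K → ℤ) (c₀ c₁ c₂ c₃ c₄ : Fin K)
    (h01 : d c₀ < d c₁) (h12 : d c₁ < d c₂) (h23 : d c₂ < d c₃) (hmin : ∀ l, d c₀ ≤ d l)
    (hAC : (m : ℤ) * d c₂ < (m - 1 : ℤ) * d c₀ + d c₄) (hBC : (m - 1 : ℤ) * d c₁ + d c₃ < (m - 1 : ℤ) * d c₀ + d c₄)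
    {n : ℕ} (θ : Fin (n + 1) → ℤ) (p : Fin (n + 1) → Equiv.Perm (Fin m) × (Fin m → Fin K))
    (hθ : StrictMono θ) (hdom : ∀ k, IsDominant d v ε (θ k) (p k)) (hne : ∀ k : Fin n, p k.castSucc ≠ p k.succ) :
    n + 2 ≤ Nat.multichoose K m := by
  classical
  by_contra hlt
  have hn : Nat.multichoose K m ≤ n + 1 := by omega
  obtain ⟨hsm, hsurj⟩ := ParityLaw.classSym_surjective_of_full d v ε θ p hθ hdom hne hn
  -- the three pattern multisets
  have cardA : Multiset.card (Multiset.replicate m c₂) = m := Multiset.card_replicate _ _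
  have cardB : Multiset.card (c₃ ::ₘ Multiset.replicate (m - 1) c₁) = m := by
    rw [Multiset.card_cons, Multiset.card_replicate]; omega
  have cardC : Multiset.card (c₄ ::ₘ Multiset.replicate (m - 1) c₀) = m := by
    rw [Multiset.card_cons, Multiset.card_replicate]; omega
  obtain ⟨kA, hkA⟩ := hsurj ⟨Multiset.replicate m c₂, cardA⟩
  obtain ⟨kB, hkB⟩ := hsurj ⟨c₃ ::ₘ Multiset.replicate (m - 1) c₁, cardB⟩
  obtain ⟨kC, hkC⟩ := hsurj ⟨c₄ ::ₘ Multiset.replicate (m - 1) c₀, cardC⟩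
  have hkA' : (classSym (p kA) : Multiset (Fin K)) = Multiset.replicate m c₂ := congrArg Subtype.val hkA
  have hkB' : (classSym (p kB) : Multiset (Fin K)) = c₃ ::ₘ Multiset.replicate (m - 1) c₁ := congrArg Subtype.val hkB
  have hkC' : (classSym (p kC) : Multiset (Fin K)) = c₄ ::ₘ Multiset.replicate (m - 1) c₀ := congrArg Subtype.val hkC
  -- exponent facts
  have h01z : (d c₀ : ℤ) < d c₁ := by exact_mod_cast h01
  have hm1 : (1 : ℤ) ≤ (m : ℤ) - 1 := by
    have : (2 : ℤ) ≤ m := by exact_mod_cast hm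
    linarith
  have h04 : d c₀ < d c₄ := by
    have hmul : ((m : ℤ) - 1) * d c₀ ≤ ((m : ℤ) - 1) * d c₁ := mul_le_mul_of_nonneg_left h01z.le (by linarith)
    have h13z : (d c₁ : ℤ) < d c₃ := by exact_mod_cast h12.trans h23
    have : (d c₀ : ℤ) < d c₄ := by nlinarith
    exact_mod_cast this
  -- shapes
  have hlA : ∀ x, (p kA).2 x = c₂ := ParityLaw.const_of_classSym_replicate hkA'
  obtain ⟨bs, hbs, hlB⟩ := ParityLaw.oneOff_of_classSym_cons (fun h => (ne_of_lt (h12.trans h23)) (by rw [h])) hkB'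
  obtain ⟨cs, hcs, hlC⟩ := ParityLaw.oneOff_of_classSym_cons (fun h => (ne_of_lt h04) (by rw [h])) hkC'
  have hlB' : ∀ x, (p kB).2 x = if x = bs then c₃ else c₁ := by
    intro x
    by_cases hx : x = bs
    · rw [if_pos hx, hx, hbs]
    · rw [if_neg hx, hlB x hx]
  have hlC' : ∀ x, (p kC).2 x = if x = cs then c₄ else c₀ := by
    intro x
    by_cases hx : x = cs
    · rw [if_pos hx, hx, hcs]
    · rw [if_neg hx, hlC x hx]
  -- slopes of the three terms
  have slA : slope d (p kA) = (m : ℤ) * d c₂ := by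
    rw [slope_eq_of_classSym, hkA', Multiset.map_replicate, Multiset.sum_replicate, nsmul_eq_mul]
  have slB : slope d (p kB) = (d c₃ : ℤ) + (m - 1 : ℤ) * d c₁ := by
    rw [slope_eq_of_classSym, hkB', Multiset.map_cons, Multiset.sum_cons, Multiset.map_replicate, Multiset.sum_replicate,
      nsmul_eq_mul]
    push_cast [Nat.cast_sub (by omega : 1 ≤ m)]
    ring
  have slC : slope d (p kC) = (d c₄ : ℤ) + (m - 1 : ℤ) * d c₀ := by
    rw [slope_eq_of_classSym, hkC', Multiset.map_cons, Multiset.sum_cons, Multiset.map_replicate, Multiset.sum_replicate,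
      nsmul_eq_mul]
    push_cast [Nat.cast_sub (by omega : 1 ≤ m)]
    ring
  -- index order from slope order
  have hAC' : kA < kC := by
    have hs : slope d (p kA) < slope d (p kC) := by rw [slA, slC]; linarith
    exact hsm.lt_iff_lt.mp hs
  have hBC' : kB < kC := by
    have hs : slope d (p kB) < slope d (p kC) := by rw [slB, slC]; linarith
    exact hsm.lt_iff_lt.mp hs
  have hA : IsDominant d v ε (θ kA) ((p kA).1, (p kA).2) := hdom kA
  have hB : IsDominant d v ε (θ kB) ((p kB).1, (p kB).2) := hdom kB
  have hC : IsDominant d v ε (θ kC) ((p kC).1, (p kC).2) := hdom kC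
  exact parity_core_all d v ε hm h01 h12 h23 hmin hlA hlB' hlC' hA hB hC (hθ hAC') (hθ hBC')

/-- **PARITY CENSUS AT EVERY SIZE, `DesignRowD` form.** [this cell] -/
theorem designRowD_parity_all (hm : 2 ≤ m) (d : Fin K → ℕ) (v ε : Fin m → Fin m → Fin K → ℤ) (c₀ c₁ c₂ c₃ c₄ : Fin K)
    (h01 : d c₀ < d c₁) (h12 : d c₁ < d c₂) (h23 : d c₂ < d c₃) (hmin : ∀ l, d c₀ ≤ d l)
    (hAC : (m : ℤ) * d c₂ < (m - 1 : ℤ) * d c₀ + d c₄) (hBC : (m - 1 : ℤ) * d c₁ + d c₃ < (m - 1 : ℤ) * d c₀ + d c₄) :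
    DesignRowD d v ε (Nat.multichoose K m - 2) := by
  intro n θ p hθ hdom hne
  have := parity_census_all hm d v ε c₀ c₁ c₂ c₃ c₄ h01 h12 h23 hmin hAC hBC θ p hθ hdom hne
  omega

end Summit.ValiantsHypothesis.ValiantsHypothesis.Theorems.KPlusLogSqLaw.TopHeavyCore
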